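import Summits.ResolutionOfSingularities.ResolutionOfSingularities.Theorems.WeightedInvariantHypersurfaceLocalGameEFT3
import Summits.ResolutionOfSingularities.ResolutionOfSingularities.Theorems.WeightedInvariantHypersurfaceCentreAssemblyDefs
import Literature.AlgebraicGeometry.Resolution.SmoothStalksRegular
import Literature.AlgebraicGeometry.Resolution.RegularLocalRingsProofs
import HarnessLib

/-!
# Door assembly H2c″ — the model ↔ stalk dictionary for `ι` and `J` (used by [S3], [S4], [S6])

Route `ResolutionOfSingularities/WeightedInvariant`, crux `Theses.WeightedInvariant.HypersurfaceCentreConstruction`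
(stmt-ResolutionOfSingularities-19897), door line `local-engine`, assembly of record (res-L1-w43-stub-9 = res-D-brk-1).
The assembly evaluates the local game's class functions `ι`, `J` on the STALK `𝒪_{Y,y}` at the local equation
`localGenerator X y`; the clauses of H2a‴ (`CanonicalGameClause`, `JOpenPresentation`, …) are read on finite-type
MODELS `A = Γ(Y, U)`, `𝔮` = the prime of `y`, `F` a section generating `X(U)`. This file is the dictionary:

* `iota_eq_of_span_singleton_eq` / `J_eq_of_span_singleton_eq` — two generators of the same principal ideal of a domain give
  the same `ι` / `J` ((c12a) unit invariance);
* `iotaAt_eq_iota_localization` — for `y ∈ U` (affine), `X(U) = (F)`, `𝔮` the prime of `y`: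
  `iotaAt ι X y = ι (Localization.AtPrime 𝔮) (F/1)` ((c6) along `𝒪_{Y,y} ≅ Γ(Y,U)_𝔮` + (c12a));
* `J_localGenerator_eq_map` — `J(𝒪_{Y,y}, localGenerator X y)ₙ = (J(Γ(Y,U)_𝔮, F/1)ₙ).map e` for the canonical
  `e : Γ(Y,U)_𝔮 ≃ₐ 𝒪_{Y,y}`, and consequently `(I.map (algebraMap _ (Localization.AtPrime 𝔮))).map e = I.map (germ)`.
Def-free helper (`--supports stmt-ResolutionOfSingularities-19897`); no claim about Hironaka's problem.
-/

noncomputable section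

set_option linter.dupNamespace false -- mandated namespace of this single-conjunct summit

open CategoryTheory AlgebraicGeometry TopologicalSpace IsLocalRing
open Literature.AlgebraicGeometry.Resolution
open Summit.ResolutionOfSingularities.ResolutionOfSingularities.Theorems

namespace Summit.ResolutionOfSingularities.ResolutionOfSingularities.Cruxes.HypersurfaceCentreConstruction.LocalEngine

variable (ι : (R : Type) → [CommRing R] → R → Ordinal.{0}) (J : (R : Type) → [CommRing R] → R → ℕ → Ideal R)

/-! ## Unit invariance read on principal ideals -/

section Units

variable {S : Type} [CommRing S] [IsDomain S]

/-- Two generators of the same principal ideal of a domain have the same `ι` (unit invariance (c12a)). [folklore] -/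
theorem iota_eq_of_span_singleton_eq (hu : IotaUnitInvariant ι) {a b : S}
    (h : Ideal.span ({a} : Set S) = Ideal.span {b}) : ι S a = ι S b := by
  obtain ⟨v, hv⟩ := Ideal.span_singleton_eq_span_singleton.mp h
  rw [← hv, mul_comm]
  exact (hu S (v : S) a v.isUnit).symm

/-- Two generators of the same principal ideal of a domain have the same `J` (unit invariance (c12a)). [folklore] -/
theorem J_eq_of_span_singleton_eq (hJu : JUnitInvariant J) {a b : S}
    (h : Ideal.span ({a} : Set S) = Ideal.span {b}) (n : ℕ) : J S a n = J S b n := by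
  obtain ⟨v, hv⟩ := Ideal.span_singleton_eq_span_singleton.mp h
  rw [← hv, mul_comm]
  exact (hJu S (v : S) a n v.isUnit).symm

end Units

/-! ## The stalk at a point of an affine chart versus the localized model -/

section Chart

variable {Y : Scheme.{0}} (U : Y.affineOpens) {y : Y} (hy : y ∈ (U : Y.Opens))

/-- The canonical ring isomorphism `Γ(Y, U)_𝔮 ≃ 𝒪_{Y,y}`, `𝔮` the prime of `y ∈ U` (the stalk is the localization of the
sections at the prime of the point). [folklore] -/
def stalkEquiv : Localization.AtPrime (U.2.primeIdealOf ⟨y, hy⟩).asIdeal ≃+* Y.presheaf.stalk y :=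
  letI := TopCat.Presheaf.algebra_section_stalk Y.presheaf (⟨y, hy⟩ : (U : Y.Opens))
  haveI : IsLocalization.AtPrime (Y.presheaf.stalk y) (U.2.primeIdealOf ⟨y, hy⟩).asIdeal := U.2.isLocalization_stalk ⟨y, hy⟩
  (IsLocalization.algEquiv (U.2.primeIdealOf ⟨y, hy⟩).asIdeal.primeCompl (Y.presheaf.stalk y)
    (Localization.AtPrime (U.2.primeIdealOf ⟨y, hy⟩).asIdeal)).symm.toRingEquiv

/-- `stalkEquiv` sends `F/1` to the germ of `F`. [folklore] -/
theorem stalkEquiv_algebraMap (F : Γ(Y, U)) :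
    stalkEquiv U hy (algebraMap Γ(Y, U) (Localization.AtPrime (U.2.primeIdealOf ⟨y, hy⟩).asIdeal) F) =
      (Y.presheaf.germ (U : Y.Opens) y hy).hom F := by
  letI := TopCat.Presheaf.algebra_section_stalk Y.presheaf (⟨y, hy⟩ : (U : Y.Opens))
  haveI : IsLocalization.AtPrime (Y.presheaf.stalk y) (U.2.primeIdealOf ⟨y, hy⟩).asIdeal := U.2.isLocalization_stalk ⟨y, hy⟩
  exact (IsLocalization.algEquiv (U.2.primeIdealOf ⟨y, hy⟩).asIdeal.primeCompl (Y.presheaf.stalk y)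
    (Localization.AtPrime (U.2.primeIdealOf ⟨y, hy⟩).asIdeal)).symm.commutes F

/-- Ideals extended to `Γ(Y,U)_𝔮` and moved along `stalkEquiv` are the ideals extended along the germ map. [folklore] -/
theorem map_stalkEquiv_map (I : Ideal Γ(Y, U)) :
    (I.map (algebraMap Γ(Y, U) (Localization.AtPrime (U.2.primeIdealOf ⟨y, hy⟩).asIdeal))).map
        (stalkEquiv U hy : _ →+* Y.presheaf.stalk y) =
      I.map (Y.presheaf.germ (U : Y.Opens) y hy).hom := by
  rw [Ideal.map_map]
  congr 1
  ext F
  exact stalkEquiv_algebraMap U hy F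

variable {U hy}

/-- When `X(U) = (F)`, the germ of `F` generates the stalk ideal `X_y`. [folklore] -/
theorem stalkIdeal_eq_span_germ (X : Y.IdealSheafData) {F : Γ(Y, U)} (hF : X.ideal U = Ideal.span {F}) :
    stalkIdeal X y = Ideal.span {(Y.presheaf.germ (U : Y.Opens) y hy).hom F} := by
  rw [stalkIdeal_eq_map_germ X U hy, hF, Ideal.map_span, Set.image_singleton]

/-- When `X(U) = (F)`, the local equation `localGenerator X y` and the germ of `F` generate the same (principal) stalk
ideal. [folklore] -/
theorem span_localGenerator_eq_span_germ (X : Y.IdealSheafData) {F : Γ(Y, U)} (hF : X.ideal U = Ideal.span {F}) :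
    Ideal.span {localGenerator X y} = Ideal.span {(Y.presheaf.germ (U : Y.Opens) y hy).hom F} := by
  rw [← stalkIdeal_eq_span_localGenerator X y ⟨_, stalkIdeal_eq_span_germ (hy := hy) X hF⟩,
    stalkIdeal_eq_span_germ (hy := hy) X hF]

/-- **`ι` at a point, read on the localized model**: for `Y → Spec k` smooth (so `𝒪_{Y,y}` is a regular local DOMAIN),
`y ∈ U` affine with `X(U) = (F)` and `𝔮` the prime of `y`: `iotaAt ι X y = ι (Γ(Y,U)_𝔮) (F/1)` ((c6) along `stalkEquiv`,
(c12a) for the two local equations). [folklore] -/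
theorem iotaAt_eq_iota_localization {k : Type} [Field k] (f : Y ⟶ Spec (.of k)) [Smooth f]
    (hc6 : IotaIsoInvariant ι) (hu : IotaUnitInvariant ι) (X : Y.IdealSheafData) {F : Γ(Y, U)}
    (hF : X.ideal U = Ideal.span {F}) :
    iotaAt ι X y = ι (Localization.AtPrime (U.2.primeIdealOf ⟨y, hy⟩).asIdeal)
      (algebraMap Γ(Y, U) (Localization.AtPrime (U.2.primeIdealOf ⟨y, hy⟩).asIdeal) F) := by
  haveI : IsRegularLocalRing (Y.presheaf.stalk y) := isRegularLocalRing_stalk_of_smooth_of_field f y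
  haveI : IsDomain (Y.presheaf.stalk y) := isDomain_of_isRegularLocalRing (Y.presheaf.stalk y)
  unfold iotaAt
  rw [iota_eq_of_span_singleton_eq ι hu (span_localGenerator_eq_span_germ (hy := hy) X hF),
    ← stalkEquiv_algebraMap U hy F]
  exact hc6 _ _ (stalkEquiv U hy) _

/-- **`J` at a point, read on the localized model**: with the same data,
`J(𝒪_{Y,y}, localGenerator X y)ₙ = (J(Γ(Y,U)_𝔮, F/1)ₙ).map stalkEquiv` ((c6)-type transport `JIsoInvariant`, (c12a)
`JUnitInvariant`). [folklore] -/
theorem J_localGenerator_eq_map {k : Type} [Field k] (f : Y ⟶ Spec (.of k)) [Smooth f]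
    (hJ : JIsoInvariant J) (hJu : JUnitInvariant J) (X : Y.IdealSheafData) {F : Γ(Y, U)}
    (hF : X.ideal U = Ideal.span {F}) (n : ℕ) :
    J (Y.presheaf.stalk y) (localGenerator X y) n =
      (J (Localization.AtPrime (U.2.primeIdealOf ⟨y, hy⟩).asIdeal)
        (algebraMap Γ(Y, U) (Localization.AtPrime (U.2.primeIdealOf ⟨y, hy⟩).asIdeal) F) n).map
        (stalkEquiv U hy : _ →+* Y.presheaf.stalk y) := by
  haveI : IsRegularLocalRing (Y.presheaf.stalk y) := isRegularLocalRing_stalk_of_smooth_of_field f y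
  haveI : IsDomain (Y.presheaf.stalk y) := isDomain_of_isRegularLocalRing (Y.presheaf.stalk y)
  rw [J_eq_of_span_singleton_eq J hJu (span_localGenerator_eq_span_germ (hy := hy) X hF) n,
    ← stalkEquiv_algebraMap U hy F]
  exact hJ _ _ (stalkEquiv U hy)
    (algebraMap Γ(Y, U) (Localization.AtPrime (U.2.primeIdealOf ⟨y, hy⟩).asIdeal) F) n

/-- Consequently, if on the model `J(Γ(Y,U)_𝔮, F/1)ₙ = Iₙ · Γ(Y,U)_𝔮` for ideals `Iₙ ⊆ Γ(Y, U)` (a presentation), then on the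
stalk `J(𝒪_{Y,y}, localGenerator X y)ₙ = Iₙ · 𝒪_{Y,y}` (extension along the germ map). [folklore] -/
theorem J_localGenerator_eq_map_germ_of_presentation {k : Type} [Field k] (f : Y ⟶ Spec (.of k)) [Smooth f]
    (hJ : JIsoInvariant J) (hJu : JUnitInvariant J) (X : Y.IdealSheafData) {F : Γ(Y, U)}
    (hF : X.ideal U = Ideal.span {F}) {n : ℕ} {I : Ideal Γ(Y, U)}
    (hpres : J (Localization.AtPrime (U.2.primeIdealOf ⟨y, hy⟩).asIdeal)
        (algebraMap Γ(Y, U) (Localization.AtPrime (U.2.primeIdealOf ⟨y, hy⟩).asIdeal) F) n =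
      I.map (algebraMap Γ(Y, U) (Localization.AtPrime (U.2.primeIdealOf ⟨y, hy⟩).asIdeal))) :
    J (Y.presheaf.stalk y) (localGenerator X y) n = I.map (Y.presheaf.germ (U : Y.Opens) y hy).hom := by
  rw [J_localGenerator_eq_map J (hy := hy) f hJ hJu X hF n, hpres, map_stalkEquiv_map U hy I]

end Chart

end Summit.ResolutionOfSingularities.ResolutionOfSingularities.Cruxes.HypersurfaceCentreConstruction.LocalEngine

end
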